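import Summits.BirchSwinnertonDyer.BirchSwinnertonDyer.Theorems.BiquadraticEisensteinDescentHeegnerTwistCouplingInSupplySymbolicMonskyTransversalTools

set_option linter.dupNamespace false -- `Summit.BirchSwinnertonDyer.BirchSwinnertonDyer.Theorems.…` (summit = sub)
set_option autoImplicit false

/-!
# Crux `HeegnerTwistCouplingInSupply` (stmt-BirchSwinnertonDyer-21381) — the TRANSVERSALITY THEOREM over `𝔽₂`
# (abstract linear algebra behind the uniform existence of pattern-free Heegner recipes at `t = t₀`)

Route `BiquadraticEisensteinDescent` (cell `pub/bsd-wall`, width seat `bsd-wall-cm-bed-w3` g22; `--supports` 21381, helper). File (2/2); tools in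
`…SymbolicMonskyTransversalTools`.

THE THEOREM (★ `exists_dual_family_separating`). Let `E` be a finite-dimensional `𝔽₂`-space, `a b : E → V` linear with `ker a ⊓ ker b = ⊥`,
and `W ≤ E` a subspace of dimension `2τ` such that `W ⊓ ker a`, `W ⊓ ker b`, `W ⊓ ker (a + b)` all have dimension `≤ τ`. Then there are `τ`
linear forms `f₁ … f_τ` on `V` such that the `2τ` forms `f_i ∘ a`, `f_i ∘ b` separate `W` (`w ∈ W`, `f_i (a w) = f_i (b w) = 0 ∀ i ⇒ w = 0`).
With `E = V × V` and `a, b` the projections (★ `exists_dual_family_separating_prod`): a `2τ`-dimensional `W ≤ V ⊕ V` meeting `V × 0`,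
`0 × V` and the diagonal in dimension `≤ τ` admits a codimension-`≤ τ` subspace `Z = ⋂ ker f_i` with `W ∩ (Z ⊕ Z) = 0` — the three obvious
necessary conditions are sufficient. (Machine-checked exhaustively beforehand for `dim V ≤ 4`: all 221 601 even-dimensional subspaces of `𝔽₂⁸`;
it is false for odd-dimensional `W` / without the diagonal condition, and false over larger fields without more slope conditions.)

WHY IT IS HERE (memo PATTERN-FREE-STRUCTURE-w3g21 §5 «what a uniform theorem must say», this seat's memo THEOREM-A): for a base configuration of the
corner layer with virtual kernel `𝒦` (`s* = dim 𝒦 + 1 = 2τ₀`) and `𝒦⁺ = 𝒦 ⊕ ⟨(δ, 1)⟩`, a Z-design (free cells with symbol vectors `σ_j`,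
`Z = {σ_j}^⊥`) is a ONE-STAGE pattern-free recipe iff `(u, w) ↦ (Sᵀw, Sᵀu)` is bijective on `𝒦⁺`, i.e. iff `𝒦⁺ ∩ (Z ⊕ Z) = 0` with `τ = τ₀`
cells; and `dim 𝒦⁺ ∩ (V×0) = κ_u + ε`, `dim 𝒦⁺ ∩ (0×V) = κ_w + [δ ∈ 𝒰]`, `dim 𝒦⁺ ∩ Δ = κ_v + [δ+1 ∈ 𝒱]`. Hence this theorem yields, at EVERY
`k`, a pattern-free Heegner recipe with the optimal `t = t₀ = s*/2 + 1` auxiliary primes for every base with `t_pred = t₀` (all configurations but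
a thin aligned class: 2 of 4096 at `k = 3`) — the `s* = 2` theorem `…SymbolicMonskyTwoPrime` being the case `τ₀ = 1`. Companion files turn the
forms into cells and Monsky matrices.

PROOF: induction on `τ` (`exists_dual_family_separating`). One form `f` is chosen with `f∘a`, `f∘b` independent on `W` and not killing the TIGHT
kernels (those of dimension exactly `τ`); by the symmetry `a, b, a+b` the bad set is always a union of at most THREE annihilators, of subspaces of
dimension `≥ 2` when `τ ≥ 2` (`exists_good_dual`, eight tightness cases), so `exists_not_mem_of_three` applies; the last step `τ = 1` is
`exists_dual_last`. Then recurse on `W ⊓ ker (f∘a) ⊓ ker (f∘b)` (`finrank_cut_add_two`, `finrank_inf_ker_le_of_tight`).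

HONEST FRAMING: pure linear algebra over `ZMod 2`; proves nothing about any curve by itself; the crux (C⁺), its registered stubs and BSD are
untouched; nothing is closed. THEOREMS ONLY (no definitions, no named facts).
-/

namespace Summit.BirchSwinnertonDyer.BirchSwinnertonDyer.Theorems.SymbolicMonsky

namespace Transversal

open Module Submodule

section Step

variable {E V : Type*} [AddCommGroup E] [Module (ZMod 2) E] [AddCommGroup V] [Module (ZMod 2) V]
  [FiniteDimensional (ZMod 2) E]
variable (a b : E →ₗ[ZMod 2] V)

/-- ★ The good form for the induction step (current dimension `2(n+2) ≥ 4`): `f ∘ a`, `f ∘ b` independent on `W` and `f` does not kill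
the tight kernels. The bad set is a union of at most three annihilators of subspaces of dimension `≥ 2`. [folklore] -/
theorem exists_good_dual (hab : LinearMap.ker a ⊓ LinearMap.ker b = ⊥) (W : Submodule (ZMod 2) E) (n : ℕ)
    (hW : finrank (ZMod 2) W = 2 * (n + 2)) (hka : finrank (ZMod 2) ↥(W ⊓ LinearMap.ker a) ≤ n + 2)
    (hkb : finrank (ZMod 2) ↥(W ⊓ LinearMap.ker b) ≤ n + 2)
    (hkc : finrank (ZMod 2) ↥(W ⊓ LinearMap.ker (a + b)) ≤ n + 2) :
    ∃ f : Dual (ZMod 2) V,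
      (∃ w ∈ W, f (a w) ≠ 0) ∧ (∃ w ∈ W, f (b w) ≠ 0) ∧ (∃ w ∈ W, f (a w) ≠ f (b w)) ∧
      (finrank (ZMod 2) ↥(W ⊓ LinearMap.ker a) = n + 2 → ∃ w ∈ W, a w = 0 ∧ f (b w) ≠ 0) ∧
      (finrank (ZMod 2) ↥(W ⊓ LinearMap.ker b) = n + 2 → ∃ w ∈ W, b w = 0 ∧ f (a w) ≠ 0) ∧
      (finrank (ZMod 2) ↥(W ⊓ LinearMap.ker (a + b)) = n + 2 → ∃ w ∈ W, (a + b) w = 0 ∧ f (a w) ≠ 0) := by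
  classical
  have dA := finrank_map_eq_sub W a
  have dB := finrank_map_eq_sub W b
  have dC := finrank_map_eq_sub W (a + b)
  have dKa := finrank_map_inf_ker_eq a b hab W
  have dKc := finrank_map_inf_ker_add_eq a b hab W
  have hba : LinearMap.ker b ⊓ LinearMap.ker a = ⊥ := by rw [inf_comm]; exact hab
  have dKb := finrank_map_inf_ker_eq b a hba W
  -- I_c from a witness of `f ∘ (a+b) ≠ 0`
  have Ic_of : ∀ (f : Dual (ZMod 2) V), (∃ w ∈ W, f ((a + b) w) ≠ 0) → ∃ w ∈ W, f (a w) ≠ f (b w) := by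
    rintro f ⟨w, hw, hfw⟩
    refine ⟨w, hw, ?_⟩
    rw [LinearMap.add_apply, map_add] at hfw
    exact (zmod2_add_ne_zero_iff _ _).mp hfw
  by_cases ta : finrank (ZMod 2) ↥(W ⊓ LinearMap.ker a) = n + 2 <;>
  by_cases tb : finrank (ZMod 2) ↥(W ⊓ LinearMap.ker b) = n + 2 <;>
  by_cases tc : finrank (ZMod 2) ↥(W ⊓ LinearMap.ker (a + b)) = n + 2
  · -- a b c tight: {b(Wa), a(Wb), a(Wc)}
    obtain ⟨f, h1, h2, h3⟩ := exists_not_mem_of_three ((W ⊓ LinearMap.ker a).map b).dualAnnihilator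
      ((W ⊓ LinearMap.ker b).map a).dualAnnihilator ((W ⊓ LinearMap.ker (a + b)).map a).dualAnnihilator
      (exists_not_mem_dualAnnihilator_of_ne_bot _ (fun h0 => by rw [h0, finrank_bot] at dKa; omega))
      (exists_not_mem_dualAnnihilator_of_ne_bot _ (fun h0 => by rw [h0, finrank_bot] at dKb; omega))
      (exists_pair_not_mem_dualAnnihilator_of_one_lt_finrank _ (by omega))
    obtain ⟨wa, hwa, hwa0, hfa⟩ := exists_mem_ker_ne_zero W a b h1
    obtain ⟨wb, hwb, hwb0, hfb⟩ := exists_mem_ker_ne_zero W b a h2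
    obtain ⟨wc, hwc, hwc0, hfc⟩ := exists_mem_ker_ne_zero W (a + b) a h3
    refine ⟨f, ⟨wb, hwb, hfb⟩, ⟨wa, hwa, hfa⟩, ⟨wb, hwb, by rw [hwb0, map_zero]; exact hfb⟩,
      fun _ => ⟨wa, hwa, hwa0, hfa⟩, fun _ => ⟨wb, hwb, hwb0, hfb⟩, fun _ => ⟨wc, hwc, hwc0, hfc⟩⟩
  · -- a b tight, c not: {b(Wa), a(Wb)} (+ any third, take a(Wb) again)
    obtain ⟨f, h1, h2, -⟩ := exists_not_mem_of_three ((W ⊓ LinearMap.ker a).map b).dualAnnihilator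
      ((W ⊓ LinearMap.ker b).map a).dualAnnihilator ((W ⊓ LinearMap.ker b).map a).dualAnnihilator
      (exists_not_mem_dualAnnihilator_of_ne_bot _ (fun h0 => by rw [h0, finrank_bot] at dKa; omega))
      (exists_not_mem_dualAnnihilator_of_ne_bot _ (fun h0 => by rw [h0, finrank_bot] at dKb; omega))
      (exists_pair_not_mem_dualAnnihilator_of_one_lt_finrank _ (by omega))
    obtain ⟨wa, hwa, hwa0, hfa⟩ := exists_mem_ker_ne_zero W a b h1
    obtain ⟨wb, hwb, hwb0, hfb⟩ := exists_mem_ker_ne_zero W b a h2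
    refine ⟨f, ⟨wb, hwb, hfb⟩, ⟨wa, hwa, hfa⟩, ⟨wb, hwb, by rw [hwb0, map_zero]; exact hfb⟩,
      fun _ => ⟨wa, hwa, hwa0, hfa⟩, fun _ => ⟨wb, hwb, hwb0, hfb⟩, fun h => absurd h tc⟩
  · -- a c tight, b not: {b(Wa), a(Wc)}: I_a from a(Wc), I_b,I_c from b(Wa)
    obtain ⟨f, h1, h3, -⟩ := exists_not_mem_of_three ((W ⊓ LinearMap.ker a).map b).dualAnnihilator
      ((W ⊓ LinearMap.ker (a + b)).map a).dualAnnihilator ((W ⊓ LinearMap.ker (a + b)).map a).dualAnnihilator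
      (exists_not_mem_dualAnnihilator_of_ne_bot _ (fun h0 => by rw [h0, finrank_bot] at dKa; omega))
      (exists_not_mem_dualAnnihilator_of_ne_bot _ (fun h0 => by rw [h0, finrank_bot] at dKc; omega))
      (exists_pair_not_mem_dualAnnihilator_of_one_lt_finrank _ (by omega))
    obtain ⟨wa, hwa, hwa0, hfa⟩ := exists_mem_ker_ne_zero W a b h1
    obtain ⟨wc, hwc, hwc0, hfc⟩ := exists_mem_ker_ne_zero W (a + b) a h3
    refine ⟨f, ⟨wc, hwc, hfc⟩, ⟨wa, hwa, hfa⟩, ⟨wa, hwa, by rw [hwa0, map_zero]; exact hfa.symm⟩,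
      fun _ => ⟨wa, hwa, hwa0, hfa⟩, fun h => absurd h tb, fun _ => ⟨wc, hwc, hwc0, hfc⟩⟩
  · -- a tight only: {b(Wa), aW}; I_c from b(Wa)
    obtain ⟨f, h1, h2, -⟩ := exists_not_mem_of_three ((W ⊓ LinearMap.ker a).map b).dualAnnihilator
      (W.map a).dualAnnihilator (W.map a).dualAnnihilator
      (exists_not_mem_dualAnnihilator_of_ne_bot _ (fun h0 => by rw [h0, finrank_bot] at dKa; omega))
      (exists_not_mem_dualAnnihilator_of_ne_bot _ (fun h0 => by rw [h0, finrank_bot] at dA; omega))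
      (exists_pair_not_mem_dualAnnihilator_of_one_lt_finrank _ (by omega))
    obtain ⟨wa, hwa, hwa0, hfa⟩ := exists_mem_ker_ne_zero W a b h1
    obtain ⟨w2, hw2, hf2⟩ := exists_mem_ne_zero_of_not_mem _ a h2
    refine ⟨f, ⟨w2, hw2, hf2⟩, ⟨wa, hwa, hfa⟩, ⟨wa, hwa, by rw [hwa0, map_zero]; exact hfa.symm⟩,
      fun _ => ⟨wa, hwa, hwa0, hfa⟩, fun h => absurd h tb, fun h => absurd h tc⟩
  · -- b c tight, a not: {a(Wb), a(Wc)} covers aW, bW, cW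
    obtain ⟨f, h2, h3, -⟩ := exists_not_mem_of_three ((W ⊓ LinearMap.ker b).map a).dualAnnihilator
      ((W ⊓ LinearMap.ker (a + b)).map a).dualAnnihilator ((W ⊓ LinearMap.ker (a + b)).map a).dualAnnihilator
      (exists_not_mem_dualAnnihilator_of_ne_bot _ (fun h0 => by rw [h0, finrank_bot] at dKb; omega))
      (exists_not_mem_dualAnnihilator_of_ne_bot _ (fun h0 => by rw [h0, finrank_bot] at dKc; omega))
      (exists_pair_not_mem_dualAnnihilator_of_one_lt_finrank _ (by omega))
    obtain ⟨wb, hwb, hwb0, hfb⟩ := exists_mem_ker_ne_zero W b a h2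
    obtain ⟨wc, hwc, hwc0, hfc⟩ := exists_mem_ker_ne_zero W (a + b) a h3
    have hbc : f (b wc) ≠ 0 := by
      have e : a wc = b wc := by
        rw [LinearMap.add_apply] at hwc0
        exact eq_of_add_eq_zero_F2 hwc0
      rw [← e]; exact hfc
    refine ⟨f, ⟨wb, hwb, hfb⟩, ⟨wc, hwc, hbc⟩, ⟨wb, hwb, by rw [hwb0, map_zero]; exact hfb⟩,
      fun h => absurd h ta, fun _ => ⟨wb, hwb, hwb0, hfb⟩, fun _ => ⟨wc, hwc, hwc0, hfc⟩⟩
  · -- b tight only: {a(Wb), bW}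
    obtain ⟨f, h2, h1, -⟩ := exists_not_mem_of_three ((W ⊓ LinearMap.ker b).map a).dualAnnihilator
      (W.map b).dualAnnihilator (W.map b).dualAnnihilator
      (exists_not_mem_dualAnnihilator_of_ne_bot _ (fun h0 => by rw [h0, finrank_bot] at dKb; omega))
      (exists_not_mem_dualAnnihilator_of_ne_bot _ (fun h0 => by rw [h0, finrank_bot] at dB; omega))
      (exists_pair_not_mem_dualAnnihilator_of_one_lt_finrank _ (by omega))
    obtain ⟨wb, hwb, hwb0, hfb⟩ := exists_mem_ker_ne_zero W b a h2
    obtain ⟨w1, hw1, hf1⟩ := exists_mem_ne_zero_of_not_mem _ b h1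
    refine ⟨f, ⟨wb, hwb, hfb⟩, ⟨w1, hw1, hf1⟩, ⟨wb, hwb, by rw [hwb0, map_zero]; exact hfb⟩,
      fun h => absurd h ta, fun _ => ⟨wb, hwb, hwb0, hfb⟩, fun h => absurd h tc⟩
  · -- c tight only: {a(Wc), cW}
    obtain ⟨f, h3, h4, -⟩ := exists_not_mem_of_three ((W ⊓ LinearMap.ker (a + b)).map a).dualAnnihilator
      (W.map (a + b)).dualAnnihilator (W.map (a + b)).dualAnnihilator
      (exists_not_mem_dualAnnihilator_of_ne_bot _ (fun h0 => by rw [h0, finrank_bot] at dKc; omega))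
      (exists_not_mem_dualAnnihilator_of_ne_bot _ (fun h0 => by rw [h0, finrank_bot] at dC; omega))
      (exists_pair_not_mem_dualAnnihilator_of_one_lt_finrank _ (by omega))
    obtain ⟨wc, hwc, hwc0, hfc⟩ := exists_mem_ker_ne_zero W (a + b) a h3
    have hbc : f (b wc) ≠ 0 := by
      have e : a wc = b wc := by
        rw [LinearMap.add_apply] at hwc0
        exact eq_of_add_eq_zero_F2 hwc0
      rw [← e]; exact hfc
    refine ⟨f, ⟨wc, hwc, hfc⟩, ⟨wc, hwc, hbc⟩, Ic_of f (exists_mem_ne_zero_of_not_mem _ (a + b) h4),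
      fun h => absurd h ta, fun h => absurd h tb, fun _ => ⟨wc, hwc, hwc0, hfc⟩⟩
  · -- none tight: {aW, bW, cW}
    obtain ⟨f, h1, h2, h4⟩ := exists_not_mem_of_three (W.map a).dualAnnihilator (W.map b).dualAnnihilator
      (W.map (a + b)).dualAnnihilator
      (exists_not_mem_dualAnnihilator_of_ne_bot _ (fun h0 => by rw [h0, finrank_bot] at dA; omega))
      (exists_not_mem_dualAnnihilator_of_ne_bot _ (fun h0 => by rw [h0, finrank_bot] at dB; omega))
      (exists_pair_not_mem_dualAnnihilator_of_one_lt_finrank _ (by omega))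
    exact ⟨f, exists_mem_ne_zero_of_not_mem _ a h1, exists_mem_ne_zero_of_not_mem _ b h2,
      Ic_of f (exists_mem_ne_zero_of_not_mem _ (a + b) h4), fun h => absurd h ta, fun h => absurd h tb, fun h => absurd h tc⟩

/-- ★ The last step (current dimension `2`): a form `f` with `f ∘ a`, `f ∘ b` independent on `W`. [folklore] -/
theorem exists_dual_last (hab : LinearMap.ker a ⊓ LinearMap.ker b = ⊥) (W : Submodule (ZMod 2) E)
    (hW : finrank (ZMod 2) W = 2) (hka : finrank (ZMod 2) ↥(W ⊓ LinearMap.ker a) ≤ 1)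
    (hkb : finrank (ZMod 2) ↥(W ⊓ LinearMap.ker b) ≤ 1)
    (hkc : finrank (ZMod 2) ↥(W ⊓ LinearMap.ker (a + b)) ≤ 1) :
    ∃ f : Dual (ZMod 2) V, (∃ w ∈ W, f (a w) ≠ 0) ∧ (∃ w ∈ W, f (b w) ≠ 0) ∧ (∃ w ∈ W, f (a w) ≠ f (b w)) := by
  classical
  have dA := finrank_map_eq_sub W a
  have dB := finrank_map_eq_sub W b
  have dC := finrank_map_eq_sub W (a + b)
  have neB : W.map b ≠ ⊥ := fun h0 => by rw [h0, finrank_bot] at dB; omega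
  have neC : W.map (a + b) ≠ ⊥ := fun h0 => by rw [h0, finrank_bot] at dC; omega
  have finish : ∀ f : Dual (ZMod 2) V, f ∉ (W.map a).dualAnnihilator → f ∉ (W.map b).dualAnnihilator →
      f ∉ (W.map (a + b)).dualAnnihilator →
      (∃ w ∈ W, f (a w) ≠ 0) ∧ (∃ w ∈ W, f (b w) ≠ 0) ∧ (∃ w ∈ W, f (a w) ≠ f (b w)) := by
    intro f h1 h2 h3
    refine ⟨exists_mem_ne_zero_of_not_mem _ a h1, exists_mem_ne_zero_of_not_mem _ b h2, ?_⟩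
    obtain ⟨w, hw, hfw⟩ := exists_mem_ne_zero_of_not_mem _ (a + b) h3
    refine ⟨w, hw, ?_⟩
    rw [LinearMap.add_apply, map_add] at hfw
    exact (zmod2_add_ne_zero_iff _ _).mp hfw
  by_cases hA : W ⊓ LinearMap.ker a = ⊥
  · have d2 : 1 < finrank (ZMod 2) (W.map a) := by rw [hA, finrank_bot] at dA; omega
    obtain ⟨f, h2, h3, h1⟩ := exists_not_mem_of_three (W.map b).dualAnnihilator (W.map (a + b)).dualAnnihilator
      (W.map a).dualAnnihilator (exists_not_mem_dualAnnihilator_of_ne_bot _ neB)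
      (exists_not_mem_dualAnnihilator_of_ne_bot _ neC) (exists_pair_not_mem_dualAnnihilator_of_one_lt_finrank _ d2)
    exact ⟨f, finish f h1 h2 h3⟩
  have neA : W.map a ≠ ⊥ := fun h0 => by rw [h0, finrank_bot] at dA; omega
  by_cases hB : W ⊓ LinearMap.ker b = ⊥
  · have d2 : 1 < finrank (ZMod 2) (W.map b) := by rw [hB, finrank_bot] at dB; omega
    obtain ⟨f, h1, h3, h2⟩ := exists_not_mem_of_three (W.map a).dualAnnihilator (W.map (a + b)).dualAnnihilator
      (W.map b).dualAnnihilator (exists_not_mem_dualAnnihilator_of_ne_bot _ neA)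
      (exists_not_mem_dualAnnihilator_of_ne_bot _ neC) (exists_pair_not_mem_dualAnnihilator_of_one_lt_finrank _ d2)
    exact ⟨f, finish f h1 h2 h3⟩
  -- both kernels non-trivial: explicit witnesses
  obtain ⟨ka, hka', hka0⟩ := (Submodule.ne_bot_iff _).mp hA
  obtain ⟨kb, hkb', hkb0⟩ := (Submodule.ne_bot_iff _).mp hB
  rw [Submodule.mem_inf, LinearMap.mem_ker] at hka' hkb'
  have hx : a kb ≠ 0 := by
    intro h0
    have : kb ∈ LinearMap.ker a ⊓ LinearMap.ker b := Submodule.mem_inf.mpr ⟨h0, hkb'.2⟩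
    rw [hab] at this
    exact hkb0 this
  have hy : b ka ≠ 0 := by
    intro h0
    have : ka ∈ LinearMap.ker a ⊓ LinearMap.ker b := Submodule.mem_inf.mpr ⟨hka'.2, h0⟩
    rw [hab] at this
    exact hka0 this
  have nx : (Submodule.span (ZMod 2) {a kb}) ≠ ⊥ := by
    rw [Submodule.ne_bot_iff]; exact ⟨a kb, Submodule.mem_span_singleton_self _, hx⟩
  have ny : (Submodule.span (ZMod 2) {b ka}) ≠ ⊥ := by
    rw [Submodule.ne_bot_iff]; exact ⟨b ka, Submodule.mem_span_singleton_self _, hy⟩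
  obtain ⟨f, hf1, hf2⟩ := exists_not_mem_of_two (Submodule.span (ZMod 2) {a kb}).dualAnnihilator
    (Submodule.span (ZMod 2) {b ka}).dualAnnihilator (exists_not_mem_dualAnnihilator_of_ne_bot _ nx)
    (exists_not_mem_dualAnnihilator_of_ne_bot _ ny)
  have fx : f (a kb) ≠ 0 := by
    intro h0; apply hf1
    rw [Submodule.mem_dualAnnihilator]
    intro t ht
    obtain ⟨c, rfl⟩ := Submodule.mem_span_singleton.mp ht
    rw [map_smul, h0, smul_zero]
  have fy : f (b ka) ≠ 0 := by
    intro h0; apply hf2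
    rw [Submodule.mem_dualAnnihilator]
    intro t ht
    obtain ⟨c, rfl⟩ := Submodule.mem_span_singleton.mp ht
    rw [map_smul, h0, smul_zero]
  refine ⟨f, ⟨kb, hkb'.1, fx⟩, ⟨ka, hka'.1, fy⟩, ⟨ka, hka'.1, ?_⟩⟩
  rw [hka'.2, map_zero]
  exact fy.symm

end Step

/-! ## §5 The theorem -/

section Main

variable {E V : Type*} [AddCommGroup E] [Module (ZMod 2) E] [AddCommGroup V] [Module (ZMod 2) V]
  [FiniteDimensional (ZMod 2) E]
variable (a b : E →ₗ[ZMod 2] V)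

/-- Every element of `ZMod 2` is `0` or `1`. [folklore] -/
private theorem zmod2_cases (x : ZMod 2) : x = 0 ∨ x = 1 := by
  revert x; decide

/-- In `ZMod 2`, non-zero means `= 1`. [folklore] -/
private theorem zmod2_ne_zero_iff' (x : ZMod 2) : x ≠ 0 ↔ x = 1 := by
  revert x; decide

/-- Cutting `W` by two forms that are independent on it lowers the dimension by two. [folklore] -/
theorem finrank_cut_add_two (W : Submodule (ZMod 2) E) (φ ψ : Dual (ZMod 2) E) (h1 : ∃ w ∈ W, φ w ≠ 0)
    (h2 : ∃ w ∈ W, ψ w ≠ 0) (h3 : ∃ w ∈ W, φ w ≠ ψ w) :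
    finrank (ZMod 2) ↥(W ⊓ LinearMap.ker φ ⊓ LinearMap.ker ψ) + 2 = finrank (ZMod 2) W := by
  have s1 := finrank_inf_ker_add_one W φ h1
  have h2' : ∃ w ∈ W ⊓ LinearMap.ker φ, ψ w ≠ 0 := by
    obtain ⟨wb, hwb, hψb⟩ := h2
    obtain ⟨wc, hwc, hne⟩ := h3
    by_cases hφb : φ wb = 0
    · exact ⟨wb, Submodule.mem_inf.mpr ⟨hwb, hφb⟩, hψb⟩
    by_cases hφc : φ wc = 0
    · have : ψ wc ≠ 0 := fun h => hne (by rw [hφc, h])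
      exact ⟨wc, Submodule.mem_inf.mpr ⟨hwc, hφc⟩, this⟩
    · have e1 : φ wb = 1 := (zmod2_ne_zero_iff' _).mp hφb
      have e2 : ψ wb = 1 := (zmod2_ne_zero_iff' _).mp hψb
      have e3 : φ wc = 1 := (zmod2_ne_zero_iff' _).mp hφc
      have e4 : ψ wc = 0 := by
        rcases zmod2_cases (ψ wc) with h | h
        · exact h
        · exact absurd (e3.trans h.symm) hne
      refine ⟨wb + wc, Submodule.mem_inf.mpr ⟨W.add_mem hwb hwc, ?_⟩, ?_⟩
      · rw [LinearMap.mem_ker, map_add, e1, e3]; decide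
      · rw [map_add, e2, e4]; decide
  have s2 := finrank_inf_ker_add_one (W ⊓ LinearMap.ker φ) ψ h2'
  omega

/-- The bound for the cut kernel: `dim (X ⊓ ker ψ) ≤ n` from `dim X ≤ n + 1` and a witness when tight. [folklore] -/
theorem finrank_inf_ker_le_of_tight (X : Submodule (ZMod 2) E) (ψ : Dual (ZMod 2) E) (n : ℕ)
    (hX : finrank (ZMod 2) X ≤ n + 1) (ht : finrank (ZMod 2) X = n + 1 → ∃ x ∈ X, ψ x ≠ 0) :
    finrank (ZMod 2) ↥(X ⊓ LinearMap.ker ψ) ≤ n := by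
  by_cases h : finrank (ZMod 2) X = n + 1
  · have := finrank_inf_ker_add_one X ψ (ht h); omega
  · have := finrank_inf_le_left X (LinearMap.ker ψ); omega

/-- ★ **THE TRANSVERSALITY THEOREM over `𝔽₂`.** `E` a finite-dimensional `𝔽₂`-space, `a b : E → V` linear with `ker a ⊓ ker b = ⊥`,
`W ≤ E` of dimension `2τ` meeting `ker a`, `ker b`, `ker (a + b)` in dimension `≤ τ`. Then `τ` linear forms `f : Fin τ → V*` exist whose
`2τ` pull-backs `f_i ∘ a`, `f_i ∘ b` separate the points of `W`. The three hypotheses are necessary (each of the three kernels injects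
into a `τ`-dimensional coordinate space). Proof: induction on `τ` with `exists_good_dual` / `exists_dual_last`. [folklore] -/
theorem exists_dual_family_separating (hab : LinearMap.ker a ⊓ LinearMap.ker b = ⊥) :
    ∀ (τ : ℕ) (W : Submodule (ZMod 2) E), finrank (ZMod 2) W = 2 * τ →
      finrank (ZMod 2) ↥(W ⊓ LinearMap.ker a) ≤ τ → finrank (ZMod 2) ↥(W ⊓ LinearMap.ker b) ≤ τ →
      finrank (ZMod 2) ↥(W ⊓ LinearMap.ker (a + b)) ≤ τ →
      ∃ f : Fin τ → Dual (ZMod 2) V, ∀ w ∈ W, (∀ i, f i (a w) = 0) → (∀ i, f i (b w) = 0) → w = 0 := by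
  intro τ
  induction τ with
  | zero =>
    intro W hW _ _ _
    refine ⟨fun i => i.elim0, fun w hw _ _ => ?_⟩
    have hbot : W = ⊥ := Submodule.finrank_eq_zero.mp (by omega)
    rw [hbot] at hw
    exact (Submodule.mem_bot (R := ZMod 2)).mp hw
  | succ n ih =>
    intro W hW hka hkb hkc
    -- the good first form, with the tightness facts needed for the bounds (vacuous at `n = 0`)
    obtain ⟨f, hIa, hIb, hIc, hTa, hTb, hTc⟩ : ∃ f : Dual (ZMod 2) V,
        (∃ w ∈ W, f (a w) ≠ 0) ∧ (∃ w ∈ W, f (b w) ≠ 0) ∧ (∃ w ∈ W, f (a w) ≠ f (b w)) ∧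
        (finrank (ZMod 2) ↥(W ⊓ LinearMap.ker a) = n + 1 → 0 < n → ∃ w ∈ W, a w = 0 ∧ f (b w) ≠ 0) ∧
        (finrank (ZMod 2) ↥(W ⊓ LinearMap.ker b) = n + 1 → 0 < n → ∃ w ∈ W, b w = 0 ∧ f (a w) ≠ 0) ∧
        (finrank (ZMod 2) ↥(W ⊓ LinearMap.ker (a + b)) = n + 1 → 0 < n → ∃ w ∈ W, (a + b) w = 0 ∧ f (a w) ≠ 0) := by
      rcases Nat.eq_zero_or_pos n with hn | hn
      · subst hn
        obtain ⟨f, h1, h2, h3⟩ := exists_dual_last a b hab W (by omega) (by omega) (by omega) (by omega)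
        exact ⟨f, h1, h2, h3, fun _ h => absurd h (lt_irrefl 0), fun _ h => absurd h (lt_irrefl 0),
          fun _ h => absurd h (lt_irrefl 0)⟩
      · obtain ⟨m, rfl⟩ : ∃ m, n = m + 1 := ⟨n - 1, by omega⟩
        obtain ⟨f, h1, h2, h3, h4, h5, h6⟩ := exists_good_dual a b hab W m (by omega) (by omega) (by omega) (by omega)
        exact ⟨f, h1, h2, h3, fun h _ => h4 h, fun h _ => h5 h, fun h _ => h6 h⟩
    -- the cut `W' = W ⊓ ker (f∘a) ⊓ ker (f∘b)`
    have hdim : finrank (ZMod 2) ↥(W ⊓ LinearMap.ker (f ∘ₗ a) ⊓ LinearMap.ker (f ∘ₗ b)) + 2 = finrank (ZMod 2) W :=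
      finrank_cut_add_two W (f ∘ₗ a) (f ∘ₗ b) hIa hIb hIc
    have memW' : ∀ w, w ∈ W ⊓ LinearMap.ker (f ∘ₗ a) ⊓ LinearMap.ker (f ∘ₗ b) ↔ w ∈ W ∧ f (a w) = 0 ∧ f (b w) = 0 := by
      intro w
      simp only [Submodule.mem_inf, LinearMap.mem_ker, LinearMap.coe_comp, Function.comp_apply, and_assoc]
    -- bounds for the cut
    have bounds : finrank (ZMod 2) ↥(W ⊓ LinearMap.ker (f ∘ₗ a) ⊓ LinearMap.ker (f ∘ₗ b) ⊓ LinearMap.ker a) ≤ n ∧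
        finrank (ZMod 2) ↥(W ⊓ LinearMap.ker (f ∘ₗ a) ⊓ LinearMap.ker (f ∘ₗ b) ⊓ LinearMap.ker b) ≤ n ∧
        finrank (ZMod 2) ↥(W ⊓ LinearMap.ker (f ∘ₗ a) ⊓ LinearMap.ker (f ∘ₗ b) ⊓ LinearMap.ker (a + b)) ≤ n := by
      rcases Nat.eq_zero_or_pos n with hn | hn
      · subst hn
        have h0 : finrank (ZMod 2) ↥(W ⊓ LinearMap.ker (f ∘ₗ a) ⊓ LinearMap.ker (f ∘ₗ b)) = 0 := by omega
        refine ⟨?_, ?_, ?_⟩ <;> exact (finrank_inf_le_left _ _).trans (by omega)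
      have leA : W ⊓ LinearMap.ker (f ∘ₗ a) ⊓ LinearMap.ker (f ∘ₗ b) ⊓ LinearMap.ker a ≤
          W ⊓ LinearMap.ker a ⊓ LinearMap.ker (f ∘ₗ b) := by
        intro w hw
        rw [Submodule.mem_inf, memW', LinearMap.mem_ker] at hw
        simp only [Submodule.mem_inf, LinearMap.mem_ker, LinearMap.coe_comp, Function.comp_apply]
        exact ⟨⟨hw.1.1, hw.2⟩, hw.1.2.2⟩
      have leB : W ⊓ LinearMap.ker (f ∘ₗ a) ⊓ LinearMap.ker (f ∘ₗ b) ⊓ LinearMap.ker b ≤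
          W ⊓ LinearMap.ker b ⊓ LinearMap.ker (f ∘ₗ a) := by
        intro w hw
        rw [Submodule.mem_inf, memW', LinearMap.mem_ker] at hw
        simp only [Submodule.mem_inf, LinearMap.mem_ker, LinearMap.coe_comp, Function.comp_apply]
        exact ⟨⟨hw.1.1, hw.2⟩, hw.1.2.1⟩
      have leC : W ⊓ LinearMap.ker (f ∘ₗ a) ⊓ LinearMap.ker (f ∘ₗ b) ⊓ LinearMap.ker (a + b) ≤
          W ⊓ LinearMap.ker (a + b) ⊓ LinearMap.ker (f ∘ₗ a) := by
        intro w hw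
        rw [Submodule.mem_inf, memW', LinearMap.mem_ker] at hw
        simp only [Submodule.mem_inf, LinearMap.mem_ker, LinearMap.coe_comp, Function.comp_apply]
        exact ⟨⟨hw.1.1, hw.2⟩, hw.1.2.1⟩
      refine ⟨(Submodule.finrank_mono leA).trans (finrank_inf_ker_le_of_tight _ _ n hka fun ht => ?_),
        (Submodule.finrank_mono leB).trans (finrank_inf_ker_le_of_tight _ _ n hkb fun ht => ?_),
        (Submodule.finrank_mono leC).trans (finrank_inf_ker_le_of_tight _ _ n hkc fun ht => ?_)⟩
      · obtain ⟨w, hw, hw0, hfw⟩ := hTa ht hn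
        exact ⟨w, Submodule.mem_inf.mpr ⟨hw, hw0⟩, by simpa using hfw⟩
      · obtain ⟨w, hw, hw0, hfw⟩ := hTb ht hn
        exact ⟨w, Submodule.mem_inf.mpr ⟨hw, hw0⟩, by simpa using hfw⟩
      · obtain ⟨w, hw, hw0, hfw⟩ := hTc ht hn
        exact ⟨w, Submodule.mem_inf.mpr ⟨hw, LinearMap.mem_ker.mpr hw0⟩, by simpa using hfw⟩
    obtain ⟨f', hf'⟩ := ih (W ⊓ LinearMap.ker (f ∘ₗ a) ⊓ LinearMap.ker (f ∘ₗ b)) (by omega) bounds.1 bounds.2.1 bounds.2.2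
    refine ⟨Fin.cons f f', fun w hw h1 h2 => ?_⟩
    have hw' : w ∈ W ⊓ LinearMap.ker (f ∘ₗ a) ⊓ LinearMap.ker (f ∘ₗ b) := by
      rw [memW']
      exact ⟨hw, by simpa using h1 0, by simpa using h2 0⟩
    exact hf' w hw' (fun i => by simpa using h1 i.succ) (fun i => by simpa using h2 i.succ)

/-- ★ **Transversality for subspaces of `V ⊕ V`** (the form used by the corner layer): a `2τ`-dimensional `W ≤ V × V` meeting
`V × 0`, `0 × V` and the diagonal in dimension `≤ τ` admits `τ` forms `f_i` with: `w ∈ W`, `f_i (w.1) = f_i (w.2) = 0 ∀ i ⇒ w = 0`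
(equivalently `W ∩ (Z ⊕ Z) = 0` for `Z = ⋂ ker f_i`, a subspace of codimension `≤ τ`). [folklore] -/
theorem exists_dual_family_separating_prod [FiniteDimensional (ZMod 2) V] (τ : ℕ) (W : Submodule (ZMod 2) (V × V))
    (hW : finrank (ZMod 2) W = 2 * τ)
    (h1 : finrank (ZMod 2) ↥(W ⊓ LinearMap.ker (LinearMap.snd (ZMod 2) V V)) ≤ τ)
    (h2 : finrank (ZMod 2) ↥(W ⊓ LinearMap.ker (LinearMap.fst (ZMod 2) V V)) ≤ τ)
    (h3 : finrank (ZMod 2) ↥(W ⊓ LinearMap.ker (LinearMap.fst (ZMod 2) V V + LinearMap.snd (ZMod 2) V V)) ≤ τ) :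
    ∃ f : Fin τ → Dual (ZMod 2) V, ∀ w ∈ W, (∀ i, f i w.1 = 0) → (∀ i, f i w.2 = 0) → w = 0 := by
  have hab : LinearMap.ker (LinearMap.fst (ZMod 2) V V) ⊓ LinearMap.ker (LinearMap.snd (ZMod 2) V V) = ⊥ := by
    rw [eq_bot_iff]
    intro w hw
    rw [Submodule.mem_inf, LinearMap.mem_ker, LinearMap.mem_ker, LinearMap.fst_apply, LinearMap.snd_apply] at hw
    rw [Submodule.mem_bot]
    exact Prod.ext hw.1 hw.2
  obtain ⟨f, hf⟩ := exists_dual_family_separating (LinearMap.fst (ZMod 2) V V) (LinearMap.snd (ZMod 2) V V) hab τ W hW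
    h2 h1 h3
  exact ⟨f, fun w hw hf1 hf2 => hf w hw hf1 hf2⟩

end Main

end Transversal

end Summit.BirchSwinnertonDyer.BirchSwinnertonDyer.Theorems.SymbolicMonsky
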